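import Summits.Schanuel.Schanuel.Theorems.RootDecomp1EAnchorDefs
import Literature.NumberTheory.Transcendental.SchanuelEclEmptyProofs
import Literature.NumberTheory.Transcendental.OneMotiveToric

/-!
# RootDecomp1E — anchor calculus, part 1: TOOLKIT (𝕃 bookkeeping, transcendence-degree and algebraicity bookkeeping)

Port (census seat, prover role) of the toolkit of lens-2's node «AnchorTower» (`HOME/decomp-schanuel-lens-2/g6/AnchorTower.lean`,
critic CLEARED 2026-08-30T07:30:30Z), serving the support item `OffAxisClosure` (stmt-Schanuel-30101) proved in
`RootDecomp1EOffAxisClosure`.  Folklore lemmas: closure properties of 𝕃 = `closedFormField`, tower law / subadditivity of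
`trdeg ℚ ℚ(S)`, exponentials of a ℚ-span are algebraic over `F_z = ℚ(z, e^z)`, the ALGEBRAIC DICHOTOMY behind Lin's theorem, bases of
`span_ℚ z ∩ P`, the rank of the anchor of a dark tuple.  Stays on the 1E cone (no other route's Theorems imported).  Defines nothing.
-/

set_option linter.dupNamespace false

noncomputable section

namespace Summit.Schanuel.Schanuel.Theorems.RootDecomp1EAnchor

open Complex IntermediateField
open Literature.NumberTheory.Transcendental (exists_nsmul_mem_span_int mem_adjoin_of_mem_span_int
  trdeg_adjoin_le_of_le isAlgebraic_adjoin_over_algebraAdjoin)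
open Summit.Schanuel.Schanuel.Theses.RootDecomp1E (DefectOneSchanuel ClosedFormAtomSchanuel OffAxisClosure)

/-! ## 𝕃 bookkeeping -/

/-- Membership in 𝕃 = `closedFormField`: `x` lies in every exp-closed, log-closed, relatively algebraically closed subfield. -/
theorem mem_closedFormField_iff {x : ℂ} : x ∈ closedFormField ↔
    ∀ K : IntermediateField ℚ ℂ, ((∀ w ∈ K, Complex.exp w ∈ K) ∧
      (∀ w : ℂ, Complex.exp w ∈ K → w ∈ K) ∧ ∀ w : ℂ, IsAlgebraic K w → w ∈ K) → x ∈ K := by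
  rw [closedFormField, IntermediateField.mem_sInf]
  rfl

/-- 𝕃 is closed under `exp`. -/
theorem exp_mem_closedFormField {x : ℂ} (hx : x ∈ closedFormField) : cexp x ∈ closedFormField := by
  rw [mem_closedFormField_iff] at hx ⊢
  exact fun K hK => hK.1 x (hx K hK)

/-- 𝕃 is closed under ALL logarithms. -/
theorem mem_closedFormField_of_exp_mem {x : ℂ} (hx : cexp x ∈ closedFormField) : x ∈ closedFormField := by
  rw [mem_closedFormField_iff] at hx ⊢
  exact fun K hK => hK.2.1 x (hx K hK)

/-- Algebraicity passes up along an inclusion of intermediate fields. [folklore] -/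
theorem isAlgebraic_of_le {F E : Type*} [Field F] [Field E] [Algebra F E] {E₁ E₂ : IntermediateField F E}
    (hle : E₁ ≤ E₂) {x : E} (hx : IsAlgebraic ↥E₁ x) : IsAlgebraic ↥E₂ x := by
  obtain ⟨p, hp0, hpx⟩ := hx
  have hf : Function.Injective (IntermediateField.inclusion hle).toRingHom :=
    IntermediateField.inclusion_injective hle
  refine ⟨p.map (IntermediateField.inclusion hle).toRingHom, ?_, ?_⟩
  · simpa using (Polynomial.map_injective _ hf).ne hp0
  · rw [Polynomial.aeval_def, Polynomial.eval₂_map]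
    have : (algebraMap (↥E₂) E).comp (IntermediateField.inclusion hle).toRingHom =
        algebraMap (↥E₁) E := RingHom.ext fun _ => rfl
    rw [this]
    rwa [Polynomial.aeval_def] at hpx

/-- Elements of an intermediate field are algebraic over it. -/
theorem isAlgebraic_of_mem_adjoin {L : IntermediateField ℚ ℂ} {x : ℂ} (hx : x ∈ L) : IsAlgebraic ↥L x :=
  isAlgebraic_algebraMap (⟨x, hx⟩ : ↥L)

/-- 𝕃 is relatively algebraically closed in ℂ. -/
theorem mem_closedFormField_of_isAlgebraic_closedFormField {x : ℂ} (hx : IsAlgebraic ↥closedFormField x) :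
    x ∈ closedFormField := by
  rw [mem_closedFormField_iff]
  intro K hK
  have hle : closedFormField ≤ K := sInf_le hK
  exact hK.2.2 x (isAlgebraic_of_le hle hx)

set_option synthInstance.maxHeartbeats 200000 in
/-- Tower law for generated fields, lower half `trdeg_K K(S) + trdeg_{K(S)} K(S)(T) ≤ trdeg_K K(S ∪ T)` [folklore] (the equality lives on
the 1G cone as `RootDecomp1GTransversalitySplit.trdeg_adjoin_adjoin_eq`; instantiate at `K = ℚ` by term application, never by `rw`). -/
theorem trdeg_adjoin_sum_le_union {K E : Type*} [Field K] [Field E] [Algebra K E] (S T : Set E) :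
    Algebra.trdeg K (adjoin K S) + Algebra.trdeg (adjoin K S) (adjoin (adjoin K S) T) ≤
      Algebra.trdeg K (adjoin K (S ∪ T)) := by
  have htower := trdeg_add_eq K (adjoin K S) (A := adjoin (adjoin K S) T)
  have heq : Algebra.trdeg K (adjoin (adjoin K S) T) = Algebra.trdeg K (adjoin K (S ∪ T)) := by
    rw [← (equivOfEq (adjoin_adjoin_left K S T)).trdeg_eq]
    rfl
  rw [← heq]
  exact htower.le

set_option synthInstance.maxHeartbeats 200000 in
/-- Tower law for generated fields, upper half: `trdeg_K K(S ∪ T) ≤ trdeg_K K(S) + trdeg_{K(S)} K(S)(T)`. [folklore] -/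
theorem trdeg_adjoin_union_le_sum {K E : Type*} [Field K] [Field E] [Algebra K E] (S T : Set E) :
    Algebra.trdeg K (adjoin K (S ∪ T)) ≤
      Algebra.trdeg K (adjoin K S) + Algebra.trdeg (adjoin K S) (adjoin (adjoin K S) T) := by
  have htower := trdeg_add_eq K (adjoin K S) (A := adjoin (adjoin K S) T)
  have heq : Algebra.trdeg K (adjoin (adjoin K S) T) = Algebra.trdeg K (adjoin K (S ∪ T)) := by
    rw [← (equivOfEq (adjoin_adjoin_left K S T)).trdeg_eq]
    rfl
  rw [← heq]
  exact htower.ge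

/-- A field generated by a set of at most `n` elements has transcendence degree `≤ n`. [folklore] -/
theorem trdeg_adjoin_le_nat {F E : Type*} [Field F] [Field E] [Algebra F E] (S : Set E) {n : ℕ}
    (hS : Cardinal.mk S ≤ n) : Algebra.trdeg F ↥(adjoin F S) ≤ n := by
  haveI := isAlgebraic_adjoin_over_algebraAdjoin (F := F) S
  exact ((Algebra.IsAlgebraic.trdeg_le_cardinalMk F (((↑) : adjoin F S → E) ⁻¹' S)).trans
    (Cardinal.mk_preimage_of_injective _ _ Subtype.val_injective)).trans hS

set_option synthInstance.maxHeartbeats 200000 in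
/-- Subadditivity `trdeg_K K(S ∪ T) ≤ trdeg_K K(T) + trdeg_K K(S)`. [folklore] -/
theorem trdeg_adjoin_union_le {K E : Type*} [Field K] [Field E] [Algebra K E] (S T : Set E) :
    Algebra.trdeg K ↥(adjoin K (S ∪ T)) ≤
      Algebra.trdeg K ↥(adjoin K T) + Algebra.trdeg K ↥(adjoin K S) := by
  rw [add_comm]
  have htower := trdeg_add_eq K (adjoin K S) (A := adjoin (adjoin K S) T)
  have heq : Algebra.trdeg K (adjoin (adjoin K S) T) = Algebra.trdeg K (adjoin K (S ∪ T)) := by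
    rw [← (equivOfEq (adjoin_adjoin_left K S T)).trdeg_eq]
    rfl
  have hbc := trdeg_adjoin_le_of_le (K := K) (E := E) (F₁ := adjoin K (∅ : Set E))
    (F₂ := adjoin K S) (adjoin.mono K _ _ (Set.empty_subset S)) T
  have htower0 := trdeg_add_eq K (adjoin K (∅ : Set E)) (A := adjoin (adjoin K (∅ : Set E)) T)
  have heq0 : Algebra.trdeg K (adjoin (adjoin K (∅ : Set E)) T) = Algebra.trdeg K (adjoin K T) := by
    have h1 : Algebra.trdeg K ↥(adjoin K T) = Algebra.trdeg K ↥(adjoin K (∅ ∪ T)) := by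
      rw [Set.empty_union]
    rw [h1, ← (equivOfEq (adjoin_adjoin_left K ∅ T)).trdeg_eq]
    rfl
  have hzero : Algebra.trdeg K ↥(adjoin K (∅ : Set E)) = 0 :=
    nonpos_iff_eq_zero.mp ((trdeg_adjoin_le_nat (F := K) (∅ : Set E) (n := 0) (by simp)).trans (by simp))
  rw [hzero, zero_add, heq0] at htower0
  rw [heq] at htower
  rw [← htower, ← htower0]
  gcongr

set_option synthInstance.maxHeartbeats 200000 in
/-- `ℚ(T)` with `T` algebraic over `K` has `trdeg_ℚ ℚ(T) ≤ trdeg_ℚ K`. [folklore] -/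
theorem trdeg_adjoin_le_of_isAlgebraic {K : IntermediateField ℚ ℂ} {T : Set ℂ}
    (hT : ∀ x ∈ T, IsAlgebraic K x) :
    Algebra.trdeg ℚ ↥(adjoin ℚ T) ≤ Algebra.trdeg ℚ ↥K := by
  have hmono : Algebra.trdeg ℚ ↥(adjoin ℚ T) ≤ Algebra.trdeg ℚ ↥(adjoin ℚ ((K : Set ℂ) ∪ T)) :=
    Literature.NumberTheory.Transcendental.OneMotiveToric.trdeg_mono (adjoin.mono ℚ _ _ Set.subset_union_right)
  refine hmono.trans (le_of_eq ?_)
  haveI : Algebra.IsAlgebraic K (adjoin K T) :=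
    isAlgebraic_adjoin fun x hx => (hT x hx).isIntegral
  have h := trdeg_add_eq ℚ K (A := adjoin K T)
  rw [trdeg_eq_zero (R := K) (A := adjoin K T), add_zero] at h
  have e := (equivOfEq (restrictScalars_adjoin ℚ K T)).symm.trdeg_eq
  calc Algebra.trdeg ℚ ↥(adjoin ℚ ((K : Set ℂ) ∪ T))
      = Algebra.trdeg ℚ ↥((adjoin K T).restrictScalars ℚ) := e
    _ = Algebra.trdeg ℚ ↥(adjoin K T) := rfl
    _ = Algebra.trdeg ℚ ↥K := h.symm

/-- Transitivity: generators of `ℚ(S)` algebraic over `K` ⟹ anything algebraic over `ℚ(S)` is algebraic over `K`. -/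
theorem isAlgebraic_of_isAlgebraic_adjoin (K : IntermediateField ℚ ℂ) {S : Set ℂ}
    (hS : ∀ x ∈ S, IsAlgebraic ↥K x) {w : ℂ} (hw : IsAlgebraic ↥(adjoin ℚ S) w) :
    IsAlgebraic ↥K w := by
  set L : IntermediateField ↥K ℂ := adjoin (↥K) S with hL
  haveI : Algebra.IsAlgebraic ↥K ↥L :=
    isAlgebraic_adjoin fun x hx => (hS x hx).isIntegral
  haveI : Algebra.IsIntegral ↥K ↥L := Algebra.isAlgebraic_iff_isIntegral.mp inferInstance
  have hle : adjoin ℚ S ≤ L.restrictScalars ℚ := by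
    rw [adjoin_le_iff]
    intro x hx
    exact subset_adjoin (↥K) S hx
  have h1 : IsAlgebraic ↥(L.restrictScalars ℚ) w := isAlgebraic_of_le hle hw
  have h2 : IsAlgebraic ↥L w := h1
  exact isAlgebraic_iff_isIntegral.mpr (isIntegral_trans (R := ↥K) (A := ↥L) w
    (isAlgebraic_iff_isIntegral.mp h2))

/-- A cardinal below a natural number is a natural number below it. -/
theorem exists_nat_lt_of_lt_natCast {c : Cardinal} {n : ℕ} (h : c < (n : Cardinal)) :
    ∃ t : ℕ, t < n ∧ c = t := by
  obtain ⟨t, rfl⟩ := Cardinal.lt_aleph0.mp (h.trans (Cardinal.natCast_lt_aleph0))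
  exact ⟨t, by exact_mod_cast h, rfl⟩

/-- A cardinal at most a natural number is a natural number. -/
theorem exists_nat_eq_of_le_natCast {c : Cardinal} {n : ℕ} (h : c ≤ (n : Cardinal)) :
    ∃ t : ℕ, c = t ∧ t ≤ n := by
  have h' : c < ((n + 1 : ℕ) : Cardinal) := lt_of_le_of_lt h (by exact_mod_cast Nat.lt_succ_self n)
  obtain ⟨t, htn, ht⟩ := exists_nat_lt_of_lt_natCast h'
  exact ⟨t, ht, Nat.lt_succ_iff.mp htn⟩

/-- The span of a sub-family of `span_ℚ z` is inside `span_ℚ z`. -/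
theorem span_range_le {ι κ : Type*} {z : ι → ℂ} {w : κ → ℂ}
    (hw : ∀ j, w j ∈ Submodule.span ℚ (Set.range z)) :
    Submodule.span ℚ (Set.range w) ≤ Submodule.span ℚ (Set.range z) := by
  rw [Submodule.span_le]
  rintro _ ⟨j, rfl⟩
  exact hw j

/-- `span_ℚ z ⊆ F_z`. -/
theorem mem_adjoin_of_mem_span {ι : Type*} {z : ι → ℂ} {x : ℂ}
    (hx : x ∈ Submodule.span ℚ (Set.range z)) :
    x ∈ adjoin ℚ (Set.range z ∪ Set.range (cexp ∘ z)) := by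
  have hle : Submodule.span ℚ (Set.range z) ≤
      (adjoin ℚ (Set.range z ∪ Set.range (cexp ∘ z))).toSubalgebra.toSubmodule := by
    rw [Submodule.span_le]
    rintro _ ⟨i, rfl⟩
    exact subset_adjoin ℚ _ (Or.inl ⟨i, rfl⟩)
  exact hle hx

/-- EXPONENTIALS OF THE SPAN ARE ALGEBRAIC OVER `F_z` (`(e^v)^N = e^{N v} ∈ F_z` for `N v ∈ span_ℤ z`). -/
theorem exp_isAlgebraic_of_mem_span {ι : Type*} {z : ι → ℂ} {v : ℂ}
    (hv : v ∈ Submodule.span ℚ (Set.range z)) :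
    IsAlgebraic ↥(adjoin ℚ (Set.range z ∪ Set.range (cexp ∘ z))) (cexp v) := by
  obtain ⟨N, hN, hNv⟩ := exists_nsmul_mem_span_int z hv
  have hmem := (mem_adjoin_of_mem_span_int z hNv).2
  have hpow : cexp ((N : ℚ) • v) = cexp v ^ N := by
    rw [Nat.cast_smul_eq_nsmul, nsmul_eq_mul, Complex.exp_nat_mul]
  rw [hpow] at hmem
  exact IsAlgebraic.of_pow (Nat.pos_of_ne_zero hN) (isAlgebraic_of_mem_adjoin hmem)

/-- All generators of `F_w` are algebraic over `F_z` when `w ⊆ span_ℚ z`. -/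
theorem gens_isAlgebraic_of_mem_span {ι κ : Type*} {z : ι → ℂ} {w : κ → ℂ}
    (hw : ∀ j, w j ∈ Submodule.span ℚ (Set.range z)) :
    ∀ x ∈ Set.range w ∪ Set.range (cexp ∘ w),
      IsAlgebraic ↥(adjoin ℚ (Set.range z ∪ Set.range (cexp ∘ z))) x := by
  rintro x (⟨j, rfl⟩ | ⟨j, rfl⟩)
  · exact isAlgebraic_of_mem_adjoin (mem_adjoin_of_mem_span (hw j))
  · exact exp_isAlgebraic_of_mem_span (hw j)

/-- `trdeg F_w ≤ trdeg F_z` when `w ⊆ span_ℚ z`; hence `trdeg F` is an invariant of the ℚ-span. -/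
theorem trdeg_le_of_mem_span {ι κ : Type*} {z : ι → ℂ} {w : κ → ℂ}
    (hw : ∀ j, w j ∈ Submodule.span ℚ (Set.range z)) :
    Algebra.trdeg ℚ ↥(adjoin ℚ (Set.range w ∪ Set.range (cexp ∘ w))) ≤
      Algebra.trdeg ℚ ↥(adjoin ℚ (Set.range z ∪ Set.range (cexp ∘ z))) :=
  trdeg_adjoin_le_of_isAlgebraic (gens_isAlgebraic_of_mem_span hw)

/-- `trdeg F_z` is an invariant of the ℚ-span: tuples with the same span generate fields of equal transcendence degree. -/
theorem trdeg_eq_of_span_eq {ι κ : Type*} {z : ι → ℂ} {w : κ → ℂ}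
    (hw : ∀ j, w j ∈ Submodule.span ℚ (Set.range z)) (hz : ∀ i, z i ∈ Submodule.span ℚ (Set.range w)) :
    Algebra.trdeg ℚ ↥(adjoin ℚ (Set.range w ∪ Set.range (cexp ∘ w))) =
      Algebra.trdeg ℚ ↥(adjoin ℚ (Set.range z ∪ Set.range (cexp ∘ z))) :=
  le_antisymm (trdeg_le_of_mem_span hw) (trdeg_le_of_mem_span hz)

/-- Algebraicity transfers from `F_t` to `F_{t'}` when `t ⊆ span_ℚ t'`. -/
theorem isAlgebraic_transfer {ι κ : Type*} {t : ι → ℂ} {t' : κ → ℂ}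
    (h : ∀ k, t k ∈ Submodule.span ℚ (Set.range t')) {x : ℂ}
    (hx : IsAlgebraic ↥(adjoin ℚ (Set.range t ∪ Set.range (cexp ∘ t))) x) :
    IsAlgebraic ↥(adjoin ℚ (Set.range t' ∪ Set.range (cexp ∘ t'))) x :=
  isAlgebraic_of_isAlgebraic_adjoin _ (gens_isAlgebraic_of_mem_span h) hx

/-- The field generated by closed-form numbers and their exponentials is inside 𝕃. -/
theorem adjoin_le_closedFormField {ι : Type*} {w : ι → ℂ} (hw : ∀ j, w j ∈ closedFormField) :
    adjoin ℚ (Set.range w ∪ Set.range (cexp ∘ w)) ≤ closedFormField := by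
  rw [adjoin_le_iff]
  rintro x (⟨j, rfl⟩ | ⟨j, rfl⟩)
  · exact hw j
  · exact exp_mem_closedFormField (hw j)

/-- `span_ℚ` of an 𝕃-tuple stays in 𝕃. -/
theorem mem_closedFormField_of_mem_span {ι : Type*} {z : ι → ℂ} (hz : ∀ i, z i ∈ closedFormField)
    {x : ℂ} (hx : x ∈ Submodule.span ℚ (Set.range z)) : x ∈ closedFormField := by
  have hle : Submodule.span ℚ (Set.range z) ≤ closedFormField.toSubalgebra.toSubmodule := by
    rw [Submodule.span_le]
    rintro _ ⟨i, rfl⟩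
    exact hz i
  exact hle hx

/-- Products of algebraic elements are algebraic (via the relative algebraic closure). -/
theorem isAlgebraic_mul {K : IntermediateField ℚ ℂ} {x y : ℂ} (hx : IsAlgebraic ↥K x)
    (hy : IsAlgebraic ↥K y) : IsAlgebraic ↥K (x * y) :=
  mem_algebraicClosure_iff.mp (mul_mem (mem_algebraicClosure_iff.mpr hx) (mem_algebraicClosure_iff.mpr hy))

/-- Sums of algebraic elements are algebraic. -/
theorem isAlgebraic_add {K : IntermediateField ℚ ℂ} {x y : ℂ} (hx : IsAlgebraic ↥K x)
    (hy : IsAlgebraic ↥K y) : IsAlgebraic ↥K (x + y) :=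
  mem_algebraicClosure_iff.mp (add_mem (mem_algebraicClosure_iff.mpr hx) (mem_algebraicClosure_iff.mpr hy))

/-- DEFECT COMPARISON: `ℚ(S) ⊆ ℚ(T)`, `trdeg ℚ(T) ≤ t ≤ trdeg ℚ(S)` (`t` finite) ⟹ every element of `ℚ(T)` is algebraic over `ℚ(S)`. -/
theorem isAlgebraic_of_trdeg_sandwich {S T : Set ℂ} {x : ℂ} (hx : x ∈ adjoin ℚ T) (hST : S ⊆ T) {t : ℕ}
    (hT : Algebra.trdeg ℚ ↥(adjoin ℚ T) ≤ (t : Cardinal))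
    (hS : (t : Cardinal) ≤ Algebra.trdeg ℚ ↥(adjoin ℚ S)) :
    IsAlgebraic ↥(adjoin ℚ S) x := by
  by_contra hxt
  have h1 : (1 : Cardinal) ≤
      Algebra.trdeg ↥(adjoin ℚ S) ↥(adjoin (↥(adjoin ℚ S)) ({x} : Set ℂ)) := by
    haveI : Algebra.Transcendental ↥(adjoin ℚ S) ↥(adjoin (↥(adjoin ℚ S)) ({x} : Set ℂ)) :=
      ⟨⟨⟨x, mem_adjoin_simple_self (↥(adjoin ℚ S)) x⟩,
        fun h => hxt (IntermediateField.isAlgebraic_iff.mp h)⟩⟩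
    exact Cardinal.one_le_iff_pos.mpr (trdeg_pos ↥(adjoin ℚ S) ↥(adjoin (↥(adjoin ℚ S)) ({x} : Set ℂ)))
  have h2 := trdeg_adjoin_sum_le_union (K := ℚ) S ({x} : Set ℂ)
  have h3 : adjoin ℚ (S ∪ {x}) ≤ adjoin ℚ T :=
    adjoin_le_iff.mpr (Set.union_subset (hST.trans (subset_adjoin ℚ T))
      (Set.singleton_subset_iff.mpr hx))
  have h4 : Algebra.trdeg ℚ ↥(adjoin ℚ (S ∪ {x})) ≤ (t : Cardinal) :=
    (Literature.NumberTheory.Transcendental.OneMotiveToric.trdeg_mono h3).trans hT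
  have h5 : (t : Cardinal) + 1 ≤ (t : Cardinal) := (add_le_add hS h1).trans (h2.trans h4)
  have h6 : ((t + 1 : ℕ) : Cardinal) ≤ (t : Cardinal) := by push_cast; exact h5
  have h7 : t + 1 ≤ t := by exact_mod_cast h6
  omega

/-- A transcendental `x` generates a field of transcendence degree `≥ 1`. -/
theorem one_le_trdeg_adjoin_singleton {x : ℂ} (hx : ¬ IsAlgebraic ℚ x) :
    ((1 : ℕ) : Cardinal) ≤ Algebra.trdeg ℚ ↥(adjoin ℚ ({x} : Set ℂ)) := by
  haveI : Algebra.Transcendental ℚ ↥(adjoin ℚ ({x} : Set ℂ)) :=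
    ⟨⟨⟨x, mem_adjoin_simple_self ℚ x⟩, fun h => hx (IntermediateField.isAlgebraic_iff.mp h)⟩⟩
  exact_mod_cast Cardinal.one_le_iff_pos.mpr (trdeg_pos ℚ ↥(adjoin ℚ ({x} : Set ℂ)))

/-- **ALGEBRAIC DICHOTOMY (heart of Lin's theorem).** If `trdeg ℚ(x, e^x) ≤ 1` and exactly one of `x`, `e^x` is algebraic over `K`, that one is algebraic over ℚ. -/
theorem algebraic_dichotomy (K : IntermediateField ℚ ℂ) (x : ℂ)
    (hT : Algebra.trdeg ℚ ↥(adjoin ℚ (Set.range (fun _ : Fin 1 => x) ∪ Set.range (cexp ∘ fun _ : Fin 1 => x)))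
      ≤ ((1 : ℕ) : Cardinal))
    (hnot : ¬ (IsAlgebraic ↥K x ∧ IsAlgebraic ↥K (cexp x)))
    (hstep : IsAlgebraic ↥K x ∨ IsAlgebraic ↥K (cexp x)) :
    IsAlgebraic ℚ x ∨ IsAlgebraic ℚ (cexp x) := by
  have hxT : x ∈ adjoin ℚ (Set.range (fun _ : Fin 1 => x) ∪ Set.range (cexp ∘ fun _ : Fin 1 => x)) :=
    subset_adjoin ℚ _ (Or.inl ⟨0, rfl⟩)
  have heT : cexp x ∈ adjoin ℚ (Set.range (fun _ : Fin 1 => x) ∪ Set.range (cexp ∘ fun _ : Fin 1 => x)) :=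
    subset_adjoin ℚ _ (Or.inr ⟨0, rfl⟩)
  rcases hstep with h | h
  · left
    by_contra hxt
    have halg : IsAlgebraic ↥(adjoin ℚ ({x} : Set ℂ)) (cexp x) :=
      isAlgebraic_of_trdeg_sandwich heT (Set.singleton_subset_iff.mpr (Or.inl ⟨0, rfl⟩)) hT
        (one_le_trdeg_adjoin_singleton hxt)
    have : IsAlgebraic ↥K (cexp x) :=
      isAlgebraic_of_isAlgebraic_adjoin K (S := ({x} : Set ℂ))
        (fun w hw => by rw [Set.mem_singleton_iff.mp hw]; exact h) halg
    exact hnot ⟨h, this⟩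
  · right
    by_contra het
    have halg : IsAlgebraic ↥(adjoin ℚ ({cexp x} : Set ℂ)) x :=
      isAlgebraic_of_trdeg_sandwich hxT (Set.singleton_subset_iff.mpr (Or.inr ⟨0, rfl⟩)) hT
        (one_le_trdeg_adjoin_singleton het)
    have : IsAlgebraic ↥K x :=
      isAlgebraic_of_isAlgebraic_adjoin K (S := ({cexp x} : Set ℂ))
        (fun w hw => by rw [Set.mem_singleton_iff.mp hw]; exact h) halg
    exact hnot ⟨this, h⟩

/-- The generators of `F_{(v,z)}` are algebraic over `K ⊇ F_z` when `v, e^v` are. -/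
theorem gens_cons_isAlgebraic (K : IntermediateField ℚ ℂ) {n : ℕ} (z : Fin n → ℂ) (v : ℂ)
    (hK : adjoin ℚ (Set.range z ∪ Set.range (cexp ∘ z)) ≤ K) (hv : IsAlgebraic ↥K v) (hev : IsAlgebraic ↥K (cexp v)) :
    ∀ x ∈ Set.range (Fin.cons v z : Fin (n + 1) → ℂ) ∪ Set.range (cexp ∘ (Fin.cons v z : Fin (n + 1) → ℂ)),
      IsAlgebraic ↥K x := by
  rintro x (⟨i, rfl⟩ | ⟨i, rfl⟩)
  · refine Fin.cases ?_ (fun j => ?_) i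
    · simpa using hv
    · simp only [Fin.cons_succ]
      exact isAlgebraic_of_le hK (isAlgebraic_of_mem_adjoin (subset_adjoin ℚ _ (Or.inl ⟨j, rfl⟩)))
  · refine Fin.cases ?_ (fun j => ?_) i
    · simpa using hev
    · simp only [Function.comp_apply, Fin.cons_succ]
      exact isAlgebraic_of_le hK (isAlgebraic_of_mem_adjoin (subset_adjoin ℚ _ (Or.inr ⟨j, rfl⟩)))

/-- **A basis of `span_ℚ z ∩ P`** for any ℚ-subspace `P` of ℂ, as a ℚ-independent family. -/
theorem exists_basis_span_inf {n : ℕ} (z : Fin n → ℂ) (P : Submodule ℚ ℂ) :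
    ∃ (a : ℕ) (ℓ : Fin a → ℂ), LinearIndependent ℚ ℓ ∧ (∀ j, ℓ j ∈ Submodule.span ℚ (Set.range z)) ∧
      (∀ j, ℓ j ∈ P) ∧
      ∀ x ∈ Submodule.span ℚ (Set.range z), x ∈ P → x ∈ Submodule.span ℚ (Set.range ℓ) := by
  classical
  obtain ⟨W, hW⟩ : ∃ W : Submodule ℚ ℂ, W = Submodule.span ℚ (Set.range z) ⊓ P := ⟨_, rfl⟩
  haveI : FiniteDimensional ℚ ↥(Submodule.span ℚ (Set.range z)) :=
    FiniteDimensional.span_of_finite ℚ (Set.finite_range z)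
  haveI : FiniteDimensional ℚ ↥W := by
    rw [hW]
    exact Submodule.finiteDimensional_of_le inf_le_left
  obtain ⟨b⟩ : Nonempty (Module.Basis (Fin (Module.finrank ℚ ↥W)) ℚ ↥W) := ⟨Module.finBasis ℚ ↥W⟩
  have hmemW : ∀ x, x ∈ W ↔ x ∈ Submodule.span ℚ (Set.range z) ∧ x ∈ P := fun x => by
    rw [hW]
    exact Submodule.mem_inf
  refine ⟨Module.finrank ℚ ↥W, fun k => ((b k : ↥W) : ℂ),
    b.linearIndependent.map' W.subtype (Submodule.ker_subtype _), fun k => ((hmemW _).mp (b k).2).1,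
    fun k => ((hmemW _).mp (b k).2).2, fun x hx hxP => ?_⟩
  have hxW : x ∈ W := (hmemW x).mpr ⟨hx, hxP⟩
  have hspan : Submodule.span ℚ (Set.range fun k => ((b k : ↥W) : ℂ)) = W := by
    have : (fun k => ((b k : ↥W) : ℂ)) = W.subtype ∘ b := rfl
    rw [this, Set.range_comp, Submodule.span_image, b.span_eq, Submodule.map_subtype_top]
  rw [hspan]
  exact hxW

/-- **The anchor has a basis**: a ℚ-independent closed-form family inside `span_ℚ z` spanning `span_ℚ z ∩ 𝕃`. -/
theorem exists_anchor_basis {n : ℕ} (z : Fin n → ℂ) :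
    ∃ (a : ℕ) (ℓ : Fin a → ℂ), LinearIndependent ℚ ℓ ∧ (∀ j, ℓ j ∈ Submodule.span ℚ (Set.range z)) ∧
      (∀ j, ℓ j ∈ closedFormField) ∧
      ∀ x ∈ Submodule.span ℚ (Set.range z), x ∈ closedFormField → x ∈ Submodule.span ℚ (Set.range ℓ) := by
  obtain ⟨a, ℓ, h1, h2, h3, h4⟩ := exists_basis_span_inf z closedFormField.toSubalgebra.toSubmodule
  exact ⟨a, ℓ, h1, h2, fun j => h3 j, fun x hx hxL => h4 x hx hxL⟩

/-- A basis of the anchor of a DARK tuple is strictly shorter than the tuple. -/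
theorem anchor_rank_lt {n : ℕ} {z : Fin n → ℂ} (hz : LinearIndependent ℚ z) (hd : Dark n z)
    {a : ℕ} (ℓ : Fin a → ℂ) (hℓ : LinearIndependent ℚ ℓ)
    (hℓz : ∀ j, ℓ j ∈ Submodule.span ℚ (Set.range z)) (hℓL : ∀ j, ℓ j ∈ closedFormField) : a < n := by
  classical
  have hle : Submodule.span ℚ (Set.range ℓ) ≤ Submodule.span ℚ (Set.range z) := span_range_le hℓz
  haveI : FiniteDimensional ℚ ↥(Submodule.span ℚ (Set.range z)) :=
    FiniteDimensional.span_of_finite ℚ (Set.finite_range z)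
  have hℓrk : Module.finrank ℚ ↥(Submodule.span ℚ (Set.range ℓ)) = a := by
    simpa using finrank_span_eq_card hℓ
  have hzrk : Module.finrank ℚ ↥(Submodule.span ℚ (Set.range z)) = n := by
    simpa using finrank_span_eq_card hz
  have hle' : a ≤ n := by
    rw [← hℓrk, ← hzrk]
    exact Submodule.finrank_mono hle
  rcases hle'.lt_or_eq with h | h
  · exact h
  · exfalso
    obtain ⟨i, hi⟩ := hd
    have heq : Submodule.span ℚ (Set.range ℓ) = Submodule.span ℚ (Set.range z) :=
      Submodule.eq_of_le_of_finrank_eq hle (by rw [hℓrk, hzrk, h])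
    have hzi : z i ∈ Submodule.span ℚ (Set.range ℓ) := by
      rw [heq]
      exact Submodule.subset_span ⟨i, rfl⟩
    exact hi (mem_closedFormField_of_mem_span hℓL hzi)

end Summit.Schanuel.Schanuel.Theorems.RootDecomp1EAnchor
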